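import Summits.HodgeConjecture.HodgeConjecture.Theorems.F0LD1ThetaFinGenerationCore
import Summits.HodgeConjecture.HodgeConjecture.Theorems.F0LD1ThetaDichotomyBricks
import Literature.NumberTheory.Automorphic.Liu2021.Def411WeilCarriersIrreducibleOrZeroAtLineOfContinuous
import HarnessLib

-- statements over the theta-kernel datum elaborate to very large types; elaborate sequentially (as in the ★ kit lineage)
set_option Elab.async false

/-!
# Crux `HLiu418`, line LD1, organ (Gα) — brick (Gα-Cf) `FinGeneration` DISCHARGED BY NAME:
# `finGeneration_holds : F0LD1ThetaDichotomyBricks.FinGeneration`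

Cell hodgecm-mathlib (D-0151), FLOOR 0; crux item `HLiu418` = stmt-HodgeConjecture-24832; half-A line LD1 (socket `stub_S1_facts`, #73 E1θhol; leaf
`Cruxes/HLiu418/Lines/F0_P6LD_StubS1FactsThetaRoad.lean`, ED. 8 stub `stub_brick_finGeneration : F0LD1ThetaDichotomyOfBricks.FinGeneration`), organ (Gα)
`F0LD1ThetaGermDefs.ThetaDichotomy₂ ⇐ … → ArchLadder → FinGeneration` (★ `F0LD1ThetaDichotomyOfBricks.thetaDichotomy₂_of_localBricks`).  Seat A-p13 (g40),
LD1-plan (g2) DEALS #9 (a).  THEOREMS ONLY (no `def`, no instance, no notation, no named fact, no `sorry`); `--supports stmt-HodgeConjecture-24832 --as helper`.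
Namespace `…Cruxes.HLiu418.F0LD1ThetaFinGeneration` (shared with ★ `Theorems/F0LD1ThetaFinGenerationCore.lean`).

WHAT.  `finGeneration_holds` states the brick (Gα-Cf) BY NAME — «over the `ThetaSlice₂` frames (rank 2, PINNED transport
`ιA k = (toAdeleGL g)⁻¹ · k · toAdeleGL g`, ANY character `ξ` of `[U(⟨a′⟩)]`): if `[θ^{μ_W}_{h_β ⊗ Φ_f}] ≠ 0` and `[θ^{μ_W}_{φ ⊗ Φ_f}] ∈ Q` for a closed `R`-invariant
`Q` and an archimedean `φ`, then `[θ^{μ_W}_{φ ⊗ Φ_f′}] ∈ Q` for EVERY `Φ_f′`» — so the leaf closes its stub by `stub_brick_finGeneration := F0LD1ThetaFinGeneration.finGeneration_holds`.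

PROOF.  ★ `toLp_lineThetaLift_tensor_mem_of_isIrreducibleOrZero` (the CORE: finite-adelic generation from «irreducible or zero» of the
`ξ_f`-coinvariants, generic rank, abstract transport with surjective finite part) at `N = 2`, fed with:
* the «irreducible or zero» input = ★ A-p12 (g27) `Def411WeilCarriers.isIrreducibleOrZero_weilCoinv_chiSplittingLine_of_continuous` (the CHARACTER-GENERIC
  twin of ★ `isIrreducibleOrZero_rhoVAtLine_chiSplittingLine`: [MoeglinVignerasWaldspurger1987, Chap. 3 IV.4] at the non-split places, the unitary principal
  series of `GL₂` at the split places, Flath's restricted tensor product — all ★, no automorphy of the character used), `2 ≤ n′` from `Fin 2 × Fin 1 ≃ Fin n′`;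
* the finite part of the pinned transport = the rational frame isomorphism `(finAdelicCongr … g ht hg).symm` (★ `F0LD2FrameTransportPin.finPart_pin_eq_finAdelicCongr_symm`,
  ★ `pin_finAdelicToAdelic`) — finite-adelic and surjective;
* the junction's `Fin n′` pure tensors rewritten as reindexed `(Fin 2 × Fin 1)` pure tensors: `E_{n′}(φ ⊗ Φ_f) = R_e E_{2×1}(R_{e⁻¹}^∞ φ ⊗ R_{e⁻¹}^f Φ_f)`
  (★ `piSBReindex_tmul`, ★ `schwartzReindexCLM_schwartzReindexCLM_symm`, ★ `finSBReindex_symm`), moved through the classes by ★ `toLp_lineThetaLift_congr`;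
* the brick's in-statement `haveI`s (`borel`, normality of `U(⟨a′⟩)(L⁺)`, compactness of `[U(H)]` from the definite place, the kit pair `hT`) re-derived with
  the same terms (★ `measureScaling_holds` pattern).

HONEST LABEL.  Nothing of print is asserted; HC_CM is proved only modulo the 7 printed citations (2 remaining: hLiu418 = stmt-HodgeConjecture-24832, h413 =
stmt-HodgeConjecture-24833) until rung 0 closes, and this file discharges none of them (it pays the in-house brick (Gα-Cf) of line LD1; count-neutral).

## References
* [Liu2021] Y. Liu, *Fourier–Jacobi cycles and arithmetic relative trace formula*, Camb. J. Math. 9 (2021) = arXiv:2102.11518, Def. 4.11 (l. 2090–2096);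
  proof of Prop. 4.13 Case 1 (l. 2131–2137, p. 48); App. D §D.1 Step 3 (l. 5221), Lemma D.1 (l. 5227).
* [Rallis1984] S. Rallis, Compositio Math. 51 (1984), proof of Thm. 1.2.2 p. 356.
* [MoeglinVignerasWaldspurger1987] C. Mœglin, M.-F. Vignéras, J.-L. Waldspurger, LNM 1291 (1987), Chap. 2 I.4 Exemple (1) (reindexing); Chap. 3 IV.4.
* [Flath1979] D. Flath, PSPM 33 (1979) part 1, §2, Theorem 2 ∕ Example 2.
-/

set_option autoImplicit false
set_option linter.dupNamespace false

noncomputable section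

open NumberField NumberField.InfinitePlace MeasureTheory IsDedekindDomain
open scoped Matrix Kronecker ComplexOrder ENNReal SchwartzMap TensorProduct Classical InnerProductSpace ComplexConjugate

namespace Summit.HodgeConjecture.HodgeConjecture.Cruxes.HLiu418.F0LD1ThetaFinGeneration

open _root_.MeasureTheory
open Literature.NumberTheory.Automorphic Literature.NumberTheory.Automorphic.UnitaryGroup
open Literature.NumberTheory.Automorphic.UnitaryGroup.CotangentForms
open Literature.NumberTheory.Automorphic.UnitaryCurveForms
open Literature.NumberTheory.Automorphic.IdeleClassGroup
open Literature.NumberTheory.Automorphic.Liu2021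
open Literature.NumberTheory.Automorphic.Liu2021.Def411WeilCarriers
open Literature.NumberTheory.Automorphic.Liu2021.Def411WeilCarriersDoubling
open Literature.NumberTheory.Automorphic.Liu2021.CinfThetaTorus
open Literature.NumberTheory.GaloisRepresentations
open Literature.NumberTheory.GelbartRogawski1991 Literature.NumberTheory.GelbartRogawski1991.UnitaryDualPair
open Literature.NumberTheory.GelbartRogawski1991.UnitaryDualPair.WeilCoinv
open Literature.NumberTheory.GelbartRogawski1991.GRConstruction
open Literature.NumberTheory.Weil1964
open Literature.RepresentationTheory Literature.RepresentationTheory.Liu2021 Literature.RepresentationTheory.HarrisKudlaSweet1996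
open Literature.RepresentationTheory.CompactGroups
open Literature.RepresentationTheory.HeisenbergGroup Literature.Analysis.SegalBargmann
open Literature.RepresentationTheory.KonnoKonno2007 Literature.RepresentationTheory.KonnoKonno2007.RealDualPair
open Literature.NumberTheory.Rogawski1990
open Summit.HodgeConjecture.HodgeConjecture.Cruxes.HLiu418.F0LD1ThetaTransportKit
open Summit.HodgeConjecture.HodgeConjecture.Cruxes.HLiu418.F0LD2ThetaTensorClasses
open Summit.HodgeConjecture.HodgeConjecture.Cruxes.HLiu418.F0LD2FrameTransportPin
open Summit.HodgeConjecture.HodgeConjecture.Cruxes.HLiu418.F0LD1ThetaGermDefs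
open Summit.HodgeConjecture.HodgeConjecture.Cruxes.HLiu418.F0LD1ThetaClassFinSliceFinite

set_option maxHeartbeats 800000 in -- the brick's 40-binder prefix + the reindexing rewrites (as ★ `F0LD1ThetaClassFinSliceFinite` §2∕§3)
/-- **(Gα-Cf) `FinGeneration` HOLDS** — finite-adelic generation through a closed invariant subspace for the line theta classes of the CM unitary curve
frames: `[θ^{μ_W}_{h_β ⊗ Φ_f}] ≠ 0` and `[θ^{μ_W}_{φ ⊗ Φ_f}] ∈ Q` (closed `R`-invariant) give `[θ^{μ_W}_{φ ⊗ Φ_f′}] ∈ Q` for every `Φ_f′` (★ CORE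
`toLp_lineThetaLift_tensor_mem_of_isIrreducibleOrZero` + ★ `isIrreducibleOrZero_weilCoinv_chiSplittingLine_of_continuous` + the pin ★ `F0LD2FrameTransportPin`).
[cite: Liu2021, Def. 4.11 (l. 2092–2096); proof of Prop. 4.13 Case 1 (l. 2136–2137); App. D Lemma D.1 (l. 5227)] [cite: Rallis1984, proof of Thm. 1.2.2 p. 356]
[cite: MoeglinVignerasWaldspurger1987, Chap. 3 IV.4] -/
theorem finGeneration_holds : F0LD1ThetaDichotomyOfBricks.FinGeneration := by
  intro L _ _ _ ι H dV hdV hdV0 t ht g hg _hsig hdef hdeg μ _ n' e₁ lam hlam _hw ιA hιA _ a' ξ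
  letI : MeasurableSpace (↥(UnitaryGroup.adelic (↥(maximalRealSubfield L)) L (IsCMField.complexConj L) 1 (JW (↥(maximalRealSubfield L)) L a')) ⧸ (UnitaryGroup.toAdelic (↥(maximalRealSubfield L)) L (IsCMField.complexConj L) 1 (JW (↥(maximalRealSubfield L)) L a')).range) := borel _
  haveI : BorelSpace (↥(UnitaryGroup.adelic (↥(maximalRealSubfield L)) L (IsCMField.complexConj L) 1 (JW (↥(maximalRealSubfield L)) L a')) ⧸ (UnitaryGroup.toAdelic (↥(maximalRealSubfield L)) L (IsCMField.complexConj L) 1 (JW (↥(maximalRealSubfield L)) L a')).range) := ⟨rfl⟩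
  haveI := normal_range_toAdelic_JW L a'
  haveI : CompactSpace (adelicGroupData (↥(maximalRealSubfield L)) L (IsCMField.complexConj L) 2 H).automorphicQuotient :=
    (UnitaryGroup.exists_infinitePlace_ne L hdeg ι).elim fun τ hτ =>
      UnitaryGroup.compactSpace_adelicGroupData_automorphicQuotient L 2 H
        (UnitaryGroup.anisotropic_of_formCongr_smul_eq_of_posDef L 2 H dV t ht g hg τ (hdef τ hτ))
  have hT : Continuous ιA ∧ ∀ ⦃γ : (adelicGroupData (↥(maximalRealSubfield L)) L (IsCMField.complexConj L) 2 H).Adelic⦄,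
      γ ∈ (UnitaryGroup.toAdelic (↥(maximalRealSubfield L)) L (IsCMField.complexConj L) 2 H).range →
        ιA γ ∈ (UnitaryGroup.toAdelic (↥(maximalRealSubfield L)) L (IsCMField.complexConj L) 2 (Matrix.diagonal dV)).range :=
    ⟨continuous_of_pin L 2 H dV g ιA hιA, fun _ hγ => mem_range_toAdelic_of_pin L 2 H dV t ht g hg ιA hιA hγ⟩
  intro hρ μW _ _ β Φf hne Q φ hmem Φf'
  -- rank bookkeeping: `n' = 2`
  have hn' : 2 ≤ n' := by
    have h := Fintype.card_congr e₁
    simp only [Fintype.card_prod, Fintype.card_fin] at h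
    omega
  -- the finite part of the pinned transport is the (surjective) rational frame isomorphism
  have hιAf : ∀ k, ιA (finAdelicToAdelic (↥(maximalRealSubfield L)) L (IsCMField.complexConj L) 2 H k) =
      finAdelicToAdelic (↥(maximalRealSubfield L)) L (IsCMField.complexConj L) 2 (Matrix.diagonal dV)
        (finPart (↥(maximalRealSubfield L)) L (IsCMField.complexConj L) 2 (Matrix.diagonal dV)
          (ιA (finAdelicToAdelic (↥(maximalRealSubfield L)) L (IsCMField.complexConj L) 2 H k))) := fun k => by
    rw [finPart_pin_eq_finAdelicCongr_symm L 2 H dV t ht g hg ιA hιA k, pin_finAdelicToAdelic L 2 H dV t ht g hg ιA hιA k]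
  have hsurj : Function.Surjective fun k : finAdelic (↥(maximalRealSubfield L)) L (IsCMField.complexConj L) 2 H =>
      finPart (↥(maximalRealSubfield L)) L (IsCMField.complexConj L) 2 (Matrix.diagonal dV)
        (ιA (finAdelicToAdelic (↥(maximalRealSubfield L)) L (IsCMField.complexConj L) 2 H k)) := fun k' =>
    ⟨finAdelicCongr (↥(maximalRealSubfield L)) L (IsCMField.complexConj L) g ht hg k', by
      simp only [finPart_pin_eq_finAdelicCongr_symm L 2 H dV t ht g hg ιA hιA]
      exact (finAdelicCongr (↥(maximalRealSubfield L)) L (IsCMField.complexConj L) g ht hg).symm_apply_apply k'⟩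
  -- the junction's `Fin n'` pure tensors are reindexed `(Fin 2 × Fin 1)` pure tensors
  have hre : ∀ (φ₁ : 𝓢((Fin n' → NumberField.mixedEmbedding.mixedSpace ↥(maximalRealSubfield L)), ℂ)) (Ψ : FinSB (↥(maximalRealSubfield L)) (Fin n')),
      piSchwartzBruhatEquiv (↥(maximalRealSubfield L)) (Fin n') (φ₁ ⊗ₜ[ℂ] Ψ) =
        piSBReindex (↥(maximalRealSubfield L)) e₁ (piSchwartzBruhatEquiv (↥(maximalRealSubfield L)) (Fin 2 × Fin 1)
          (schwartzReindexCLM (↥(maximalRealSubfield L)) e₁.symm φ₁ ⊗ₜ[ℂ] finSBReindex (↥(maximalRealSubfield L)) e₁.symm Ψ)) := fun φ₁ Ψ => by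
    rw [piSBReindex_tmul, schwartzReindexCLM_schwartzReindexCLM_symm, ← finSBReindex_symm, LinearEquiv.apply_symm_apply]
  rw [toLp_lineThetaLift_congr L 2 H e₁ dV hdV hdV0 ιA hT lam hlam a' hρ μW (charCM ξ) μ (hre φ Φf')]
  rw [toLp_lineThetaLift_congr L 2 H e₁ dV hdV hdV0 ιA hT lam hlam a' hρ μW (charCM ξ) μ (hre φ Φf)] at hmem
  rw [Ne, toLp_lineThetaLift_congr L 2 H e₁ dV hdV hdV0 ιA hT lam hlam a' hρ μW (charCM ξ) μ (hre _ Φf)] at hne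
  exact toLp_lineThetaLift_tensor_mem_of_isIrreducibleOrZero L 2 H e₁ dV hdV hdV0 ιA hT lam hlam a' hρ μW μ ξ
    (fun χ' hn hc => Def411WeilCarriers.isIrreducibleOrZero_weilCoinv_chiSplittingLine_of_continuous L e₁ hn' dV hdV hdV0
      (toHeckeCharacter L lam) (isUnitary_toHeckeCharacter L lam) ((isOscillatorChar_toHeckeCharacter_iff lam).mpr hlam) a' χ' hn hc)
    hιAf hsurj _ _ _ hne Q hmem _


end Summit.HodgeConjecture.HodgeConjecture.Cruxes.HLiu418.F0LD1ThetaFinGeneration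

end
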